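import Mathlib
import Summits.Ventures.FusionMHD.Models.TearingFRS1M3Coeffs
import Summits.Ventures.FusionMHD.Models.TearingFRS1QDecomp
import Literature.Analysis.ODE.RationalTaylorMajorant
import Literature.Analysis.ODE.RegularSingularScalarSystem
import HarnessLib

/-!
# F3.r3 instance «TearingFRS1.M3» ((3,2) mode): structure of the local coefficient `q` — partial fractions, the
# sharp geometric majorant, and the operator bounds `‖M_k‖ ≤ 13.11·1.3ᵏ`, `‖M_k‖ ≤ 3.82·2ᵏ`

Companion of `TearingFRS1M3.lean` / `TearingFRS1M3Coeffs.lean` (model-6 g5), pattern of `TearingFRS1QDecomp.lean`. For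
`m = 3` the local coefficient is `q(x) = −9x/(1+x)² − 560/((3x²+6x+10)²(x+2))`, so its Taylor data have the structure

  `qc n = 9n(−1)ⁿ − (14/5)(−1/2)ⁿ + e_n`

with THE SAME analytic part `e = TearingFRS1.ec` (`E = P_E/Q_E`, `|e_n| ≤ 11·(5/4)ⁿ`, `TearingFRS1.norm_ec_le` /
`hasSum_ec`, reused, not restated). Consequences drawn here: `qc_decomp`; `norm_qc_le_sharp : |qc k| ≤ 50·(5/4)ᵏ`;
the WIDE local data `isScalarLogData_wide : IsScalarLogData pc qc p q (5/4) 50 (4/5)`; the system operators `Msys`,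
`Rsys` of the instance with the HYBRID bounds **`norm_Msys_le_sharp : ‖M_k‖ ≤ (1311/100)(13/10)ᵏ`** (exact values
`k < 20`, sup `13.105` at `k = 4`; structure beyond) and **`norm_Msys_le_two : ‖M_k‖ ≤ (191/50)·2ᵏ`** (sup `3.819` at
`k = 2`) — the constants of the jet lemmas in `TearingFRS1M3Jets2.lean` (small solution at rate `2`, regular part at
rate `12/5`). Constants computed in exact rational arithmetic by `HOME/lean/tools/model-6/teargen/core.py`; every
inequality is re-checked by the kernel. [instance data]
-/

noncomputable section

open Finset Filter Polynomial Literature.Analysis.ODE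
open scoped Topology NNReal

namespace Summit.Ventures.FusionMHD.Models

namespace TearingFRS1

namespace M3

/-! ### The partial-fraction structure of `q` (`m = 3`) -/

/-- PARTIAL FRACTIONS: `q(x) = −9x/(1+x)² − (14/5)/(1 + x/2) + P_E(x)/Q_E(x)` away from `x ∈ {−1, −2}`. [instance data] -/
theorem q_partial_fractions {x : ℝ} (hx1 : 1 + x ≠ 0) (hx2 : x + 2 ≠ 0) :
    q x = -9 * x / (1 + x) ^ 2 - 14 / 5 / (1 + x / 2) + PE.eval x / QE.eval x := by
  have h3 : (3 * x ^ 2 + 6 * x + 10 : ℝ) ≠ 0 := by nlinarith [sq_nonneg (x + 1)]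
  have h2x : (2 : ℝ) + x ≠ 0 := by rwa [add_comm] at hx2
  have hQE : QE.eval x = (3 * x ^ 2 + 6 * x + 10) ^ 2 / 100 := by
    simp only [QE, eval_add, eval_mul, eval_C, eval_X, eval_pow, eval_one]; ring
  have hPE : PE.eval x = 84 / 5 * x * ((3 * x ^ 2 + 6 * x + 10) + 10) / 100 := by
    simp only [PE, eval_add, eval_mul, eval_C, eval_X, eval_pow]; ring
  rw [q_eq hx1 hx2, hQE, hPE, show (1 + x / 2 : ℝ) = (2 + x) / 2 by ring]
  set t : ℝ := 3 * x ^ 2 + 6 * x + 10 with ht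
  field_simp
  rw [ht]
  ring

/-- The two geometric parts as power series on `|x| < 1` (`m = 3`):
`Σ xⁿ (9n(−1)ⁿ − (14/5)(−1/2)ⁿ) = −9x/(1+x)² − (14/5)/(1 + x/2)`. [instance data] -/
theorem hasSum_geomPart {x : ℝ} (hx : ‖x‖ < 1) :
    HasSum (fun n : ℕ => x ^ n * (9 * (n : ℝ) * (-1) ^ n - 14 / 5 * (-1 / 2) ^ n))
      (-9 * x / (1 + x) ^ 2 - 14 / 5 / (1 + x / 2)) := by
  have h1 : HasSum (fun n : ℕ => (n : ℝ) * (-x) ^ n) ((-x) / (1 - (-x)) ^ 2) :=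
    hasSum_coe_mul_geometric_of_norm_lt_one (by rwa [norm_neg])
  have h2 : HasSum (fun n : ℕ => (-x / 2) ^ n) (1 - (-x / 2))⁻¹ := by
    refine hasSum_geometric_of_norm_lt_one ?_
    rw [norm_div, norm_neg, Real.norm_ofNat]
    linarith
  have h := (h1.mul_left 9).sub (h2.mul_left (14 / 5))
  have e1 : (1 - -x : ℝ) = 1 + x := by ring
  have e2 : (1 - -x / 2 : ℝ) = 1 + x / 2 := by ring
  have ev : 9 * (-x / (1 - -x) ^ 2) - 14 / 5 * (1 - -x / 2)⁻¹ = -9 * x / (1 + x) ^ 2 - 14 / 5 / (1 + x / 2) := by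
    rw [e1, e2, div_eq_mul_inv (14 / 5 : ℝ)]
    ring
  have ef : (fun n : ℕ => x ^ n * (9 * (n : ℝ) * (-1) ^ n - 14 / 5 * (-1 / 2) ^ n)) =
      fun n : ℕ => 9 * ((n : ℝ) * (-x) ^ n) - 14 / 5 * (-x / 2) ^ n := by
    funext n
    rw [show (-x / 2 : ℝ) = (-1 / 2) * x by ring, mul_pow, neg_pow x n]
    ring
  rw [ef, ← ev]
  exact h

/-- **THE DECOMPOSITION OF THE `q`-DATA** (`m = 3`): `qc n = 9n(−1)ⁿ − (14/5)(−1/2)ⁿ + e_n` for every `n`.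
[instance data] -/
theorem qc_decomp (n : ℕ) : qc n = 9 * (n : ℝ) * (-1) ^ n - 14 / 5 * (-1 / 2) ^ n + ec n := by
  have hqc : ∀ k, ‖qc k‖ ≤ 5 / (1 - 4 / 7) * (8 : ℝ) ^ k := fun k => by
    have h := q_taylor.1 k
    rwa [show ((1 : ℝ) / 8)⁻¹ = 8 by norm_num] at h
  have hd : ∀ k : ℕ, ‖9 * (k : ℝ) * (-1) ^ k - 14 / 5 * (-1 / 2) ^ k + ec k‖ ≤ 23 * (2 : ℝ) ^ k := fun k => by
    have hk : (k : ℝ) ≤ 2 ^ k := by exact_mod_cast (Nat.lt_two_pow_self (n := k)).le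
    have h54 : (5 / 4 : ℝ) ^ k ≤ 2 ^ k := pow_le_pow_left₀ (by norm_num) (by norm_num) k
    have hhalf : ‖(-1 / 2 : ℝ) ^ k‖ ≤ 1 := by rw [norm_pow]; exact pow_le_one₀ (norm_nonneg _) (by norm_num)
    have h1 : (1 : ℝ) ≤ 2 ^ k := one_le_pow₀ (by norm_num)
    have hA : ‖9 * (k : ℝ) * (-1) ^ k‖ = 9 * k := by
      rw [norm_mul, norm_mul, norm_pow, norm_neg, norm_one, one_pow, mul_one, Real.norm_ofNat, Real.norm_natCast]
    have hB : ‖14 / 5 * (-1 / 2 : ℝ) ^ k‖ ≤ 14 / 5 := by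
      rw [norm_mul, Real.norm_of_nonneg (by norm_num : (0 : ℝ) ≤ 14 / 5)]; nlinarith
    have hC := norm_ec_le k
    calc ‖9 * (k : ℝ) * (-1) ^ k - 14 / 5 * (-1 / 2) ^ k + ec k‖
        ≤ ‖9 * (k : ℝ) * (-1) ^ k‖ + ‖14 / 5 * (-1 / 2 : ℝ) ^ k‖ + ‖ec k‖ := norm_sub_add_le₃ _ _ _
      _ ≤ 23 * 2 ^ k := by rw [hA]; nlinarith
  refine coeff_eq_of_tsum_eq hqc (by norm_num) hd (by norm_num) (r := 1 / 8) (by norm_num) (fun x hx => ?_) n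
  have hx1 : ‖x‖ < 1 := hx.trans (by norm_num)
  have hx45 : ‖x‖ < 4 / 5 := hx.trans (by norm_num)
  have hx' : |x| < 1 / 8 := by simpa [Real.norm_eq_abs] using hx
  have hxa : 1 + x ≠ 0 := by intro h; rw [abs_lt] at hx'; linarith
  have hxb : x + 2 ≠ 0 := by intro h; rw [abs_lt] at hx'; linarith
  have hS1 : HasSum (fun k : ℕ => x ^ k * qc k) (q x) := isScalarLogData.hasSum_q x hx
  have hS2 : HasSum (fun k : ℕ => x ^ k * (9 * (k : ℝ) * (-1) ^ k - 14 / 5 * (-1 / 2) ^ k + ec k)) (q x) := by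
    have h := (hasSum_geomPart hx1).add (hasSum_ec hx45)
    rw [← q_partial_fractions hxa hxb] at h
    have ef : (fun k : ℕ => x ^ k * (9 * (k : ℝ) * (-1) ^ k - 14 / 5 * (-1 / 2) ^ k + ec k)) =
        fun k : ℕ => x ^ k * (9 * (k : ℝ) * (-1) ^ k - 14 / 5 * (-1 / 2) ^ k) + x ^ k * ec k := by
      funext k; ring
    rw [ef]
    exact h
  simp only [smul_eq_mul]
  rw [hS1.tsum_eq, hS2.tsum_eq]

/-! ### Consequences: the wide local data and the operator bounds -/

/-- SHARPER TAYLOR BOUND for `q` (`m = 3`): `|qc k| ≤ 50 · (5/4)ᵏ` for all `k`. [instance data] -/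
theorem norm_qc_le_sharp (k : ℕ) : ‖qc k‖ ≤ 50 * (5 / 4 : ℝ) ^ k := by
  rw [qc_decomp k]
  have hk := natCast_le_four_mul_pow k
  have hhalf : ‖(-1 / 2 : ℝ) ^ k‖ ≤ 1 := by rw [norm_pow]; exact pow_le_one₀ (norm_nonneg _) (by norm_num)
  have h1 : (1 : ℝ) ≤ (5 / 4) ^ k := one_le_pow₀ (by norm_num)
  have h0 : (0 : ℝ) ≤ (5 / 4) ^ k := by positivity
  have hA : ‖9 * (k : ℝ) * (-1) ^ k‖ = 9 * k := by
    rw [norm_mul, norm_mul, norm_pow, norm_neg, norm_one, one_pow, mul_one, Real.norm_ofNat, Real.norm_natCast]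
  have hB : ‖14 / 5 * (-1 / 2 : ℝ) ^ k‖ ≤ 14 / 5 := by
    rw [norm_mul, Real.norm_of_nonneg (by norm_num : (0 : ℝ) ≤ 14 / 5)]; nlinarith
  have hC := norm_ec_le k
  calc ‖9 * (k : ℝ) * (-1) ^ k - 14 / 5 * (-1 / 2) ^ k + ec k‖
      ≤ ‖9 * (k : ℝ) * (-1) ^ k‖ + ‖14 / 5 * (-1 / 2 : ℝ) ^ k‖ + ‖ec k‖ := norm_sub_add_le₃ _ _ _
    _ ≤ 50 * (5 / 4) ^ k := by rw [hA]; nlinarith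

/-- **THE WIDE LOCAL DATA** (`m = 3`): `IsScalarLogData pc qc p q (5/4) 50 (4/5)`. [instance data] -/
theorem isScalarLogData_wide : IsScalarLogData pc qc p q (5 / 4) 50 (4 / 5) where
  a_pos := by norm_num
  K_nonneg := by norm_num
  ρ₀_pos := by norm_num
  norm_pc_le k _ := (norm_pc_le_one k).trans (by
    have h1 : (1 : ℝ) ≤ (5 / 4) ^ k := one_le_pow₀ (by norm_num)
    nlinarith)
  norm_qc_le k _ := norm_qc_le_sharp k
  pc_zero := pc_zero
  hasSum_p x hx := TearingFRS1.isScalarLogData_wide.hasSum_p x hx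
  hasSum_q x hx := by
    have hx1 : ‖x‖ < 1 := hx.trans (by norm_num)
    obtain ⟨hxa, hxb⟩ := one_add_ne_zero_of_lt hx
    have h := (hasSum_geomPart hx1).add (hasSum_ec hx)
    rw [← q_partial_fractions hxa hxb] at h
    have ef : (fun k : ℕ => x ^ k * qc k) =
        fun k : ℕ => x ^ k * (9 * (k : ℝ) * (-1) ^ k - 14 / 5 * (-1 / 2) ^ k) + x ^ k * ec k := by
      funext k; rw [qc_decomp k]; ring
    rw [ef]
    exact h

/-! ### The system operators of the instance and their hybrid bounds -/

/-- The system operators `M_k` of the instance (`m = 3`). [instance data] -/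
abbrev Msys : ℕ → ℝ × ℝ →L[ℝ] ℝ × ℝ := scalarSysM pc qc

/-- The resolvents `Rₙ` of the instance (`m = 3`; `p₀ = 0`, `q₀ = −14/5` as for `m = 2`). [instance data] -/
abbrev Rsys : ℕ → ℝ × ℝ →L[ℝ] ℝ × ℝ := scalarSysR pc qc

/-- The logarithmic coefficient `κ = −q₀ · 1 = 14/5` (`m = 3`). [instance data] -/
theorem kappa_eq : -(M3.qc 0) * (1 : ℝ) = 14 / 5 := by rw [qc_zero]; norm_num

/-- Linear growth against the geometric rate `13/10` (`m = 3`): `9(20 + j) + 19/5 ≤ (13/10)^{20+j}`. [instance data] -/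
theorem lin_le_geom_aux (j : ℕ) : 9 * ((20 + j : ℕ) : ℝ) + 19 / 5 ≤ (13 / 10 : ℝ) ^ (20 + j) := by
  induction j with
  | zero => norm_num
  | succ i ih =>
    have hbase : (190 : ℝ) ≤ (13 / 10 : ℝ) ^ (20 + i) :=
      le_trans (by norm_num) (pow_le_pow_right₀ (by norm_num : (1 : ℝ) ≤ 13 / 10) (by omega : 20 ≤ 20 + i))
    rw [show 20 + (i + 1) = (20 + i) + 1 by omega, pow_succ]
    push_cast at ih ⊢
    linarith

/-- The tail structure of `|qc k| + |pc k|` for `k ≥ 20` (`m = 3`): `≤ (33/5)·(13/10)ᵏ`. [instance data] -/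
theorem norm_qc_add_pc_tail (j : ℕ) : ‖qc (20 + j)‖ + ‖pc (20 + j)‖ ≤ 33 / 5 * (13 / 10 : ℝ) ^ (20 + j) := by
  have hp := norm_pc_le_one (20 + j)
  have hq : ‖qc (20 + j)‖ ≤ 9 * ((20 + j : ℕ) : ℝ) + 14 / 5 * (1 / 2) ^ (20 + j) + 11 * (5 / 4) ^ (20 + j) := by
    rw [qc_decomp]
    calc ‖9 * ((20 + j : ℕ) : ℝ) * (-1) ^ (20 + j) - 14 / 5 * (-1 / 2) ^ (20 + j) + ec (20 + j)‖
        ≤ ‖9 * ((20 + j : ℕ) : ℝ) * (-1) ^ (20 + j)‖ + ‖14 / 5 * (-1 / 2 : ℝ) ^ (20 + j)‖ + ‖ec (20 + j)‖ :=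
          norm_sub_add_le₃ _ _ _
      _ ≤ 9 * ((20 + j : ℕ) : ℝ) + 14 / 5 * (1 / 2) ^ (20 + j) + 11 * (5 / 4) ^ (20 + j) := by
          refine add_le_add (add_le_add (le_of_eq ?_) (le_of_eq ?_)) (norm_ec_le _)
          · rw [norm_mul, norm_mul, norm_pow, norm_neg, norm_one, one_pow, mul_one, Real.norm_ofNat,
              Real.norm_natCast]
          · rw [norm_mul, norm_pow, Real.norm_of_nonneg (by norm_num : (0 : ℝ) ≤ 14 / 5), norm_div, norm_neg,
              norm_one, Real.norm_ofNat]
  have hA : 9 * ((20 + j : ℕ) : ℝ) + 14 / 5 * (1 / 2) ^ (20 + j) + 1 ≤ (13 / 10 : ℝ) ^ (20 + j) := by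
    have hhalf : (1 / 2 : ℝ) ^ (20 + j) ≤ 1 := pow_le_one₀ (by norm_num) (by norm_num)
    have H := lin_le_geom_aux j
    nlinarith
  have hB : 11 * (5 / 4 : ℝ) ^ (20 + j) ≤ 28 / 5 * (13 / 10 : ℝ) ^ (20 + j) := by
    rw [pow_add, pow_add]
    have h1 : 11 * (5 / 4 : ℝ) ^ 20 ≤ 28 / 5 * (13 / 10 : ℝ) ^ 20 := by norm_num
    have h2 : (5 / 4 : ℝ) ^ j ≤ (13 / 10 : ℝ) ^ j := pow_le_pow_left₀ (by norm_num) (by norm_num) j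
    have h3 : (0 : ℝ) ≤ (5 / 4 : ℝ) ^ j := by positivity
    have h4 : (0 : ℝ) ≤ (13 / 10 : ℝ) ^ 20 := by positivity
    nlinarith [mul_le_mul h1 h2 h3 (by positivity)]
  linarith

/-- **THE HYBRID OPERATOR BOUND** (`m = 3`) `‖M_k‖ ≤ (1311/100)·(13/10)ᵏ` for `k ≥ 1`: the exact values of
`|qc k| + |pc k|` for `k < 20` (the supremum `13.105…` is attained at `k = 4`) and the structure
`9k + 14/5·2⁻ᵏ + 11·(5/4)ᵏ + 1 ≤ 6.6·1.3ᵏ` beyond. Constant of the small-solution jet lemma. [instance data] -/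
theorem norm_Msys_le_sharp (k : ℕ) (hk : 1 ≤ k) : ‖Msys k‖ ≤ 1311 / 100 * (13 / 10 : ℝ) ^ k := by
  refine (norm_scalarSysM_le pc qc k).trans ?_
  rcases lt_or_ge k 20 with hlt | hge
  · interval_cases k
    · rw [qc_val_1, pc_val_1]; norm_num
    · rw [qc_val_2, pc_val_2]; norm_num
    · rw [qc_val_3, pc_val_3]; norm_num
    · rw [qc_val_4, pc_val_4]; norm_num
    · rw [qc_val_5, pc_val_5]; norm_num
    · rw [qc_val_6, pc_val_6]; norm_num
    · rw [qc_val_7, pc_val_7]; norm_num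
    · rw [qc_val_8, pc_val_8]; norm_num
    · rw [qc_val_9, pc_val_9]; norm_num
    · rw [qc_val_10, pc_val_10]; norm_num
    · rw [qc_val_11, pc_val_11]; norm_num
    · rw [qc_val_12, pc_val_12]; norm_num
    · rw [qc_val_13, pc_val_13]; norm_num
    · rw [qc_val_14, pc_val_14]; norm_num
    · rw [qc_val_15, pc_val_15]; norm_num
    · rw [qc_val_16, pc_val_16]; norm_num
    · rw [qc_val_17, pc_val_17]; norm_num
    · rw [qc_val_18, pc_val_18]; norm_num
    · rw [qc_val_19, pc_val_19]; norm_num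
  · have hk1 : k ≠ 1 := by omega
    rw [if_neg hk1]
    obtain ⟨j, rfl⟩ : ∃ j, k = 20 + j := ⟨k - 20, by omega⟩
    have hT : (0 : ℝ) ≤ (13 / 10 : ℝ) ^ (20 + j) := by positivity
    refine max_le (by positivity) ((norm_qc_add_pc_tail j).trans ?_)
    linarith

/-- **THE RATE-2 OPERATOR BOUND** (`m = 3`) `‖M_k‖ ≤ (191/50)·2ᵏ` for `k ≥ 1` (sup `3.819` at `k = 2`): the constant of
the regular-part jet lemma, whose rate `a` is the small solution's rate `2`. [instance data] -/
theorem norm_Msys_le_two (k : ℕ) (hk : 1 ≤ k) : ‖Msys k‖ ≤ 191 / 50 * (2 : ℝ) ^ k := by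
  refine (norm_scalarSysM_le pc qc k).trans ?_
  rcases lt_or_ge k 20 with hlt | hge
  · interval_cases k
    · rw [qc_val_1, pc_val_1]; norm_num
    · rw [qc_val_2, pc_val_2]; norm_num
    · rw [qc_val_3, pc_val_3]; norm_num
    · rw [qc_val_4, pc_val_4]; norm_num
    · rw [qc_val_5, pc_val_5]; norm_num
    · rw [qc_val_6, pc_val_6]; norm_num
    · rw [qc_val_7, pc_val_7]; norm_num
    · rw [qc_val_8, pc_val_8]; norm_num
    · rw [qc_val_9, pc_val_9]; norm_num
    · rw [qc_val_10, pc_val_10]; norm_num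
    · rw [qc_val_11, pc_val_11]; norm_num
    · rw [qc_val_12, pc_val_12]; norm_num
    · rw [qc_val_13, pc_val_13]; norm_num
    · rw [qc_val_14, pc_val_14]; norm_num
    · rw [qc_val_15, pc_val_15]; norm_num
    · rw [qc_val_16, pc_val_16]; norm_num
    · rw [qc_val_17, pc_val_17]; norm_num
    · rw [qc_val_18, pc_val_18]; norm_num
    · rw [qc_val_19, pc_val_19]; norm_num
  · have hk1 : k ≠ 1 := by omega
    rw [if_neg hk1]
    obtain ⟨j, rfl⟩ : ∃ j, k = 20 + j := ⟨k - 20, by omega⟩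
    refine max_le (by positivity) ((norm_qc_add_pc_tail j).trans ?_)
    rw [pow_add, pow_add]
    have h1 : 33 / 5 * (13 / 10 : ℝ) ^ 20 ≤ 191 / 50 * (2 : ℝ) ^ 20 := by norm_num
    have h2 : (13 / 10 : ℝ) ^ j ≤ (2 : ℝ) ^ j := pow_le_pow_left₀ (by norm_num) (by norm_num) j
    have h3 : (0 : ℝ) ≤ (13 / 10 : ℝ) ^ j := by positivity
    have h4 : (0 : ℝ) ≤ (2 : ℝ) ^ 20 := by positivity
    nlinarith [mul_le_mul h1 h2 h3 (by positivity)]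

end M3

end TearingFRS1

end Summit.Ventures.FusionMHD.Models

end
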